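import Literature.AlgebraicGeometry.AbelianSchemes.AbelianSchemeTheoremOfCubeLocallyNoetherian
import Literature.AlgebraicGeometry.AbelianSchemes.ModuleSliceOfBaseChange
import Literature.AlgebraicGeometry.Modules.PicardGroupSheafCohomologyThickening
import Literature.AlgebraicGeometry.AbelianSchemes.AbelianSchemeKOfL
import Literature.AlgebraicGeometry.Modules.DetClassOfIso
import Mathlib.LinearAlgebra.FiniteDimensional.Lemmas
import HarnessLib

/-!
# Kodaira–Spencer surjectivity for the Poincaré family, ASSEMBLY STEP: moving a lift of a point of `Â = A/K(L)` by an
# infinitesimal point of `A` with prescribed class (Mumford, *Abelian Varieties* §13, proof of the Theorem, pp. 126–127)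

Layer `Literature/AlgebraicGeometry/AbelianSchemes`, namespace `Literature.AlgebraicGeometry.AbelianSchemes.AbelianSchemeOver`.
THEOREMS ONLY (no definition, no named fact, no instance, no `sorry`).

Setting: `A, Â` abelian schemes over `S`, `π : A → Â` a homomorphism, `𝒫` of rank one on `A ×_S Â` with `(1 × π)^*𝒫 ≅ Λ(L)`
(★ `mumfordBundle`), a morphism `ι₀ : T₀ → T` over `S` such that `i := 1_A × ι₀ : A_{T₀} → A_T` is a first-order thickening
(★ `IsFirstOrderThickening`, ideal `𝓘 := idealSheafAb i`, truncated exponential `truncExp i : 𝓘 → 𝒪^×_{A_T}`).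

* **`exists_lift_detClassH_eq_add_of_square`** — IF `y ↦ [(1 × y)^*𝒫]` is multiplicative on `T`-points of `Â` (the theorem of the
  square for `𝒫` in the `Â`-variable, proved in `PoincareFamilySquare` from descent) and an infinitesimal `T`-point `k` of `A`
  (`ι₀ ≫ k = 1`) has `[(1 × k)^*Λ(L)] = exp(t)` in `H¹(A_T, 𝒪^×)` for a given `t ∈ H¹(A_T, 𝓘)`, THEN for every `g₁ : T → Â` the point
  `g₂ := π(k) · g₁` restricts to `g₁` on `T₀` and `[(1 × g₂)^*𝒫] = [(1 × g₁)^*𝒫] + exp(t)`.  This is the last step of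
  [MumfordAV1970] §13 pp. 126–127 («… we can alter the lifting … so that the two liftings of the sheaf agree»): the lift-level
  Kodaira–Spencer SURJECTIVITY of `𝒫` (node S-e of the cell's (Mc) N3′ tower) reduces to the `A`-side statement «every class in
  `H¹(𝓘)` is `[(1 × k)^*Λ(L)]` for an infinitesimal point `k` of `A`».
* `detClassH_pullback_baseChangeToProd` — the class of `(1 × g)^*𝒫` in `H¹(A_T, 𝒪^×)` read through ★ `CechPic.toSheafH`.
* `comp_eq_one_of_detClassH_mumford_eq_zero` (§2) — a `T`-point `k` of `A` with `[(1 × k)^*Λ(L)] = 0` is killed by `π` (kernel clause).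
* `surjective_of_add_of_smul_of_injective` (§3) — the linear-algebra count; **`exists_lift_detClassH_eq_add_of_count`** (§4) — S-e
  assembled from: the square for `𝒫`, a finite-dimensional parametrisation of infinitesimal points of `A` with additive, homogeneous,
  injective classes, and an additive identification of `H¹(𝓘)` with a `κ`-space of the same dimension.

Cell `hodgecm-mathlib`, F-3 child line `Cruxes/HDel/Lines/F3DualAbelianSchemeM`, stub (Mc), N3′ inner node S-e (brick (Q4)); B-p07 (g20).
HC_CM is proved only modulo the 7 printed citations until rung 0 closes; nothing here is about HC.

## References
* [MumfordAV1970] D. Mumford, *Abelian Varieties* (1970), §13, proof of the Theorem (pp. 125–130).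
* [Hartshorne2010] R. Hartshorne, *Deformation Theory* (2010), §6 Thm. 6.4 (b) (pp. 50–51).
* [Hartshorne1977] R. Hartshorne, *Algebraic Geometry* (1977), III Ex. 4.5.
-/

set_option autoImplicit false

noncomputable section

-- `TopCat.Presheaf`/`Scheme.Modules` are not reducible (as in ★ `AbelianSchemeKOfL`).
set_option backward.isDefEq.respectTransparency false

open CategoryTheory CategoryTheory.Limits AlgebraicGeometry MonoidalCategory CartesianMonoidalCategory
open scoped MonObj

namespace Literature.AlgebraicGeometry.AbelianSchemes

open Literature.AlgebraicGeometry.Motives Literature.AlgebraicGeometry.Modules Literature.AlgebraicGeometry.Deformation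

namespace AbelianSchemeOver

section Assembly

variable {S : Scheme.{0}} (A hat : AbelianSchemeOver S) (π : A.X ⟶ hat.X) [IsMonHom π]
  {L : A.left.Modules} (hL : HasRank L 1) (P : (A.prodLeft hat).Modules) (h1 : HasRank P 1)
  (hsock : Nonempty ((Scheme.Modules.pullback (A.X ◁ π).left).obj P ≅ A.mumfordBundle L))

/-- **The class of `(1 × g)^*𝒫` in `H¹(A_T, 𝒪^×)`** is the image of the Čech class `(1 × g)^*[𝒫]` (★ `detClassH_def`, ★ `detClass_pullback`,
★ `baseChangeToProd_eq_whiskerLeft_left`). [cite: Hartshorne1977, III Ex. 4.5] -/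
theorem detClassH_pullback_baseChangeToProd {T : Over S} (g : T ⟶ hat.X) :
    detClassH (HasRank.isFiniteLocallyFree' (hasRank_pullback _ h1 :
        HasRank (X := (A.X ⊗ T).left) ((Scheme.Modules.pullback (A.baseChangeToProd hat T.hom g.left (Over.w g))).obj P) 1)) =
      (CechPic.toSheafH (A.X ⊗ T).left (CechPic.pullback (A.X ◁ g).left (detClass (HasRank.isFiniteLocallyFree' h1)))).toAdd := by
  have e1 : detClass (HasRank.isFiniteLocallyFree' (hasRank_pullback _ h1 :
        HasRank (X := (A.X ⊗ T).left) ((Scheme.Modules.pullback (A.baseChangeToProd hat T.hom g.left (Over.w g))).obj P) 1)) =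
      CechPic.pullback (A.X ◁ g).left (detClass (HasRank.isFiniteLocallyFree' h1)) := by
    have e0 := (detClass_congr (HasRank.isFiniteLocallyFree' (hasRank_pullback _ h1 :
        HasRank (X := (A.X ⊗ T).left) ((Scheme.Modules.pullback (A.baseChangeToProd hat T.hom g.left (Over.w g))).obj P) 1))
      ((HasRank.isFiniteLocallyFree' h1).pullback (A.X ◁ g).left)).trans
      (detClass_pullback (A.X ◁ g).left (HasRank.isFiniteLocallyFree' h1))
    exact e0
  rw [detClassH_def, e1]

omit [IsMonHom π] in
include hsock in
/-- **`[(1 × π)^*𝒫] = [Λ(L)]`** on Čech classes (from the socket isomorphism). [cite: MumfordAV1970, §13 (pp. 125–130)] -/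
theorem cechPic_pullback_whiskerLeft_hom_poincareClass :
    CechPic.pullback (A.X ◁ π).left (detClass (HasRank.isFiniteLocallyFree' h1)) =
      A.mumfordClass (detClass (HasRank.isFiniteLocallyFree' hL)) := by
  obtain ⟨eσ⟩ := hsock
  rw [← detClass_pullback (A.X ◁ π).left (HasRank.isFiniteLocallyFree' h1),
    detClass_eq_of_iso eσ _ (HasRank.isFiniteLocallyFree' (A.hasRank_mumfordBundle hL)), A.detClass_mumfordBundle hL]

include hsock in
/-- **KODAIRA–SPENCER SURJECTIVITY, ASSEMBLY STEP** ([MumfordAV1970] §13 pp. 126–127).  Assume the theorem of the square for `𝒫` on the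
`T`-points of `Â` (`hsq`).  Let `ι₀ : T₀ → T` over `S` make `1_A × ι₀` a first-order thickening with ideal `𝓘`, let `g₁ : T → Â`, `t ∈ H¹(A_T, 𝓘)`,
and let `k : T → A` be an infinitesimal point (`ι₀ ≫ k = 1`) with `[(1 × k)^*Λ(L)] = exp(t)` in `H¹(A_T, 𝒪^×)`.  Then `g₂ := π(k) · g₁`
satisfies `ι₀ ≫ g₂ = ι₀ ≫ g₁` and `[(1 × g₂)^*𝒫] = [(1 × g₁)^*𝒫] + exp(t)`. [cite: MumfordAV1970, §13 (proof of the Theorem, pp. 125–130)]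
[cite: Hartshorne2010, §6 Thm. 6.4 (b) (pp. 50–51)] -/
theorem exists_lift_detClassH_eq_add_of_square {T₀ T : Over S} (ι₀ : T₀ ⟶ T) [IsFirstOrderThickening (A.X ◁ ι₀).left]
    (hsq : ∀ y₁ y₂ : T ⟶ hat.X,
      CechPic.pullback (A.X ◁ (y₁ * y₂)).left (detClass (HasRank.isFiniteLocallyFree' h1)) =
        CechPic.pullback (A.X ◁ y₁).left (detClass (HasRank.isFiniteLocallyFree' h1)) *
          CechPic.pullback (A.X ◁ y₂).left (detClass (HasRank.isFiniteLocallyFree' h1)))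
    (g₁ : T ⟶ hat.X) (t : (idealSheafAb (A.X ◁ ι₀).left).H 1) (k : T ⟶ A.X) (hk : ι₀ ≫ k = 1)
    (hkt : detClassH (HasRank.isFiniteLocallyFree' (hasRank_pullback (A.X ◁ k).left (A.hasRank_mumfordBundle hL))) =
      Sheaf.H.map (truncExp (A.X ◁ ι₀).left) 1 t) :
    ∃ g₂ : T ⟶ hat.X, ι₀ ≫ g₂ = ι₀ ≫ g₁ ∧
      detClassH (HasRank.isFiniteLocallyFree' (hasRank_pullback _ h1 :
          HasRank (X := (A.X ⊗ T).left) ((Scheme.Modules.pullback (A.baseChangeToProd hat T.hom g₂.left (Over.w g₂))).obj P) 1)) =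
        detClassH (HasRank.isFiniteLocallyFree' (hasRank_pullback _ h1 :
          HasRank (X := (A.X ⊗ T).left) ((Scheme.Modules.pullback (A.baseChangeToProd hat T.hom g₁.left (Over.w g₁))).obj P) 1)) +
          Sheaf.H.map (truncExp (A.X ◁ ι₀).left) 1 t := by
  refine ⟨(k ≫ π) * g₁, ?_, ?_⟩
  · rw [MonObj.comp_mul, ← Category.assoc, hk, MonObj.one_comp, one_mul]
  · -- `[(1 × π(k))^*𝒫] = (1 × k)^*[Λ(L)]`
    have hη : CechPic.pullback (A.X ◁ (k ≫ π)).left (detClass (HasRank.isFiniteLocallyFree' h1)) =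
        CechPic.pullback (A.X ◁ k).left (A.mumfordClass (detClass (HasRank.isFiniteLocallyFree' hL))) := by
      rw [MonoidalCategory.whiskerLeft_comp, Over.comp_left, CechPic.pullback_comp,
        A.cechPic_pullback_whiskerLeft_hom_poincareClass hat π hL P h1 hsock]
    -- `[(1 × k)^*Λ(L)]` read in `H¹(𝒪^×)`
    have hΛk : detClassH (HasRank.isFiniteLocallyFree' (hasRank_pullback (A.X ◁ k).left (A.hasRank_mumfordBundle hL))) =
        (CechPic.toSheafH (A.X ⊗ T).left
          (CechPic.pullback (A.X ◁ k).left (A.mumfordClass (detClass (HasRank.isFiniteLocallyFree' hL))))).toAdd := by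
      have hΛf := HasRank.isFiniteLocallyFree' (A.hasRank_mumfordBundle hL)
      have e1 : detClass (HasRank.isFiniteLocallyFree' (hasRank_pullback (A.X ◁ k).left (A.hasRank_mumfordBundle hL))) =
          CechPic.pullback (A.X ◁ k).left (detClass hΛf) :=
        (detClass_congr _ (hΛf.pullback (A.X ◁ k).left)).trans (detClass_pullback (A.X ◁ k).left hΛf)
      rw [A.detClass_mumfordBundle hL] at e1
      rw [detClassH_def, e1]
    have eA := A.detClassH_pullback_baseChangeToProd hat P h1 ((k ≫ π) * g₁)
    have eB := A.detClassH_pullback_baseChangeToProd hat P h1 g₁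
    -- Čech level: `[(1 × (π(k)·g₁))^*𝒫] = (1 × k)^*[Λ(L)] · [(1 × g₁)^*𝒫]`
    have e2 : CechPic.pullback (A.X ◁ ((k ≫ π) * g₁)).left (detClass (HasRank.isFiniteLocallyFree' h1)) =
        CechPic.pullback (A.X ◁ k).left (A.mumfordClass (detClass (HasRank.isFiniteLocallyFree' hL))) *
          CechPic.pullback (A.X ◁ g₁).left (detClass (HasRank.isFiniteLocallyFree' h1)) := by
      rw [hsq (k ≫ π) g₁, hη]
    -- additive level
    have e3 : (CechPic.toSheafH (A.X ⊗ T).left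
          (CechPic.pullback (A.X ◁ ((k ≫ π) * g₁)).left (detClass (HasRank.isFiniteLocallyFree' h1)))).toAdd =
        (CechPic.toSheafH (A.X ⊗ T).left
            (CechPic.pullback (A.X ◁ k).left (A.mumfordClass (detClass (HasRank.isFiniteLocallyFree' hL))))).toAdd +
          (CechPic.toSheafH (A.X ⊗ T).left
            (CechPic.pullback (A.X ◁ g₁).left (detClass (HasRank.isFiniteLocallyFree' h1)))).toAdd := by
      have := congrArg (fun c => (CechPic.toSheafH (A.X ⊗ T).left c).toAdd) e2
      simpa only [map_mul, toAdd_mul] using this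
    -- `(1 × k)^*[Λ(L)] ↦ exp(t)`
    have e4 : (CechPic.toSheafH (A.X ⊗ T).left
          (CechPic.pullback (A.X ◁ k).left (A.mumfordClass (detClass (HasRank.isFiniteLocallyFree' hL))))).toAdd =
        Sheaf.H.map (truncExp (A.X ◁ ι₀).left) 1 t := hΛk.symm.trans hkt
    have e5 := e3.trans (congrArg (· + (CechPic.toSheafH (A.X ⊗ T).left
      (CechPic.pullback (A.X ◁ g₁).left (detClass (HasRank.isFiniteLocallyFree' h1)))).toAdd) e4)
    exact eA.trans (e5.trans ((add_comm _ _).trans (congrArg (· + Sheaf.H.map (truncExp (A.X ◁ ι₀).left) 1 t) eB.symm)))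

end Assembly

/-! ## §2 The kernel: an infinitesimal point with trivial Mumford class is killed by `π` -/

section Kernel

variable {S : Scheme.{0}} (A hat : AbelianSchemeOver S) (π : A.X ⟶ hat.X)
  {L : A.left.Modules} (hL : HasRank L 1)
  (hker : ∀ (T : Over S) (u : T ⟶ A.X), u ≫ π = 1 ↔ A.MemKOfL L u)

include hker in
/-- **Injectivity of the `A`-side Kodaira–Spencer map** ([MumfordAV1970] §13 p. 126: «`Lie K(L) = 0`»): a `T`-point `k` of `A` whose class
`[(1 × k)^*Λ(L)]` vanishes in `H¹(A_T, 𝒪^×)` lies in `K(L)(T)`, hence is killed by `π` (kernel clause); with `π` unramified and `k`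
infinitesimal (`ι₀ ≫ k = 1`) this forces `k = 1` (★ `Morphisms/ArtinianLiftsOfSmoothEtale`, consumer side).
[cite: MumfordAV1970, §13 (proof of the Theorem, pp. 125–130)] [cite: MumfordFogartyKirwan1994, Ch. 6 §2 Definition 6.2 (p. 120)] -/
theorem comp_eq_one_of_detClassH_mumford_eq_zero {T : Over S} (k : T ⟶ A.X)
    (h : detClassH (HasRank.isFiniteLocallyFree' (hasRank_pullback (A.X ◁ k).left (A.hasRank_mumfordBundle hL))) = 0) :
    k ≫ π = 1 := by
  have hΛf := HasRank.isFiniteLocallyFree' (A.hasRank_mumfordBundle hL)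
  have e1 : detClass (HasRank.isFiniteLocallyFree' (hasRank_pullback (A.X ◁ k).left (A.hasRank_mumfordBundle hL))) =
      CechPic.pullback (A.X ◁ k).left (detClass hΛf) :=
    (detClass_congr _ (hΛf.pullback (A.X ◁ k).left)).trans (detClass_pullback (A.X ◁ k).left hΛf)
  rw [A.detClass_mumfordBundle hL] at e1
  rw [detClassH_def, e1, toAdd_eq_zero, ← map_one (CechPic.toSheafH (A.X ⊗ T).left)] at h
  exact (hker T k).2 ((A.memKOfL_iff_mumfordClass hL k).2 (CechPic.toSheafH_injective h))

end Kernel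

/-! ## §3 The count: an additive, homogeneous, injective map between spaces of the same finite dimension is onto -/

section Count

/-- **Linear-algebra core of the Kodaira–Spencer count**: `Φ : V → H` additive, injective, and `κ`-homogeneous after an additive
identification `E : H ≃+ M` with a `κ`-space `M` of the same finite dimension as `V`, is surjective ([MumfordAV1970] §13 p. 127:
«both have dimension `g`, so the map is surjective»). [cite: MumfordAV1970, §13 (proof of the Theorem, pp. 125–130)] -/
theorem surjective_of_add_of_smul_of_injective {K : Type*} [DivisionRing K] {V M H : Type*} [AddCommGroup V] [Module K V]
    [FiniteDimensional K V] [AddCommGroup M] [Module K M] [FiniteDimensional K M] [AddCommGroup H]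
    (E : H ≃+ M) (hdim : Module.finrank K V = Module.finrank K M) (Φ : V → H)
    (hadd : ∀ v w, Φ (v + w) = Φ v + Φ w) (hsmul : ∀ (c : K) (v : V), E (Φ (c • v)) = c • E (Φ v))
    (hinj : ∀ v, Φ v = 0 → v = 0) : Function.Surjective Φ := by
  let Θ : V →ₗ[K] M :=
    { toFun := fun v => E (Φ v)
      map_add' := fun v w => by rw [hadd, map_add]
      map_smul' := fun c v => hsmul c v }
  have hΘ : Function.Injective Θ := by
    intro v w hvw
    have h0 : Θ (v - w) = 0 := by rw [map_sub, hvw, sub_self]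
    have h1 : Φ (v - w) = 0 := by
      have : E (Φ (v - w)) = E 0 := by rw [map_zero]; exact h0
      exact E.injective this
    exact sub_eq_zero.1 (hinj _ h1)
  have hsurj := (LinearMap.injective_iff_surjective_of_finrank_eq_finrank hdim).1 hΘ
  intro h
  obtain ⟨v, hv⟩ := hsurj (E h)
  exact ⟨v, E.injective hv⟩

end Count

/-! ## §4 S-e from the six inputs: parametrised infinitesimal points, their classes, the count, the square -/

section Final

variable {S : Scheme.{0}} (A hat : AbelianSchemeOver S) (π : A.X ⟶ hat.X) [IsMonHom π]
  {L : A.left.Modules} (hL : HasRank L 1) (P : (A.prodLeft hat).Modules) (h1 : HasRank P 1)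
  (hsock : Nonempty ((Scheme.Modules.pullback (A.X ◁ π).left).obj P ≅ A.mumfordBundle L))

include hsock in
/-- **KODAIRA–SPENCER SURJECTIVITY OF `𝒫`, LIFT LEVEL — ASSEMBLED FROM ITS INPUTS** ([MumfordAV1970] §13 pp. 126–127).  Data: a first-order
thickening `1_A × ι₀` of `A_T`; the square for `𝒫` on `T`-points of `Â` (`hsq`); a parametrisation `pt : V → A(T)` of infinitesimal points
(`ι₀ ≫ pt v = 1`) by a finite-dimensional `κ`-space `V`, with classes `cls v ∈ H¹(𝓘)` such that `[(1 × pt v)^*Λ(L)] = exp(cls v)`, additive and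
`κ`-homogeneous through an additive identification `E : H¹(𝓘) ≃+ M` with a `κ`-space of the same dimension, and injective (`cls v = 0 → v = 0`).
Then for every `g₁ : T → Â` and `t ∈ H¹(𝓘)` there is `g₂` with `ι₀ ≫ g₂ = ι₀ ≫ g₁` and `[(1 × g₂)^*𝒫] = [(1 × g₁)^*𝒫] + exp(t)`.
[cite: MumfordAV1970, §13 (proof of the Theorem, pp. 125–130)] [cite: Hartshorne2010, §6 Thm. 6.4 (b) (pp. 50–51)] -/
theorem exists_lift_detClassH_eq_add_of_count {T₀ T : Over S} (ι₀ : T₀ ⟶ T) [IsFirstOrderThickening (A.X ◁ ι₀).left]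
    (hsq : ∀ y₁ y₂ : T ⟶ hat.X,
      CechPic.pullback (A.X ◁ (y₁ * y₂)).left (detClass (HasRank.isFiniteLocallyFree' h1)) =
        CechPic.pullback (A.X ◁ y₁).left (detClass (HasRank.isFiniteLocallyFree' h1)) *
          CechPic.pullback (A.X ◁ y₂).left (detClass (HasRank.isFiniteLocallyFree' h1)))
    {K : Type*} [Field K] {V M : Type*} [AddCommGroup V] [Module K V] [FiniteDimensional K V] [AddCommGroup M] [Module K M]
    [FiniteDimensional K M] (E : (idealSheafAb (A.X ◁ ι₀).left).H 1 ≃+ M) (hdim : Module.finrank K V = Module.finrank K M)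
    (pt : V → (T ⟶ A.X)) (hpt : ∀ v, ι₀ ≫ pt v = 1) (cls : V → (idealSheafAb (A.X ◁ ι₀).left).H 1)
    (hcls : ∀ v, detClassH (HasRank.isFiniteLocallyFree' (hasRank_pullback (A.X ◁ pt v).left (A.hasRank_mumfordBundle hL))) =
      Sheaf.H.map (truncExp (A.X ◁ ι₀).left) 1 (cls v))
    (hadd : ∀ v w, cls (v + w) = cls v + cls w) (hsmul : ∀ (c : K) (v : V), E (cls (c • v)) = c • E (cls v))
    (hinj : ∀ v, cls v = 0 → v = 0) (g₁ : T ⟶ hat.X) (t : (idealSheafAb (A.X ◁ ι₀).left).H 1) :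
    ∃ g₂ : T ⟶ hat.X, ι₀ ≫ g₂ = ι₀ ≫ g₁ ∧
      detClassH (HasRank.isFiniteLocallyFree' (hasRank_pullback _ h1 :
          HasRank (X := (A.X ⊗ T).left) ((Scheme.Modules.pullback (A.baseChangeToProd hat T.hom g₂.left (Over.w g₂))).obj P) 1)) =
        detClassH (HasRank.isFiniteLocallyFree' (hasRank_pullback _ h1 :
          HasRank (X := (A.X ⊗ T).left) ((Scheme.Modules.pullback (A.baseChangeToProd hat T.hom g₁.left (Over.w g₁))).obj P) 1)) +
          Sheaf.H.map (truncExp (A.X ◁ ι₀).left) 1 t := by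
  obtain ⟨v, hv⟩ := surjective_of_add_of_smul_of_injective E hdim cls hadd hsmul hinj t
  exact A.exists_lift_detClassH_eq_add_of_square hat π hL P h1 hsock ι₀ hsq g₁ t (pt v) (hpt v) ((hcls v).trans (by rw [hv]))

end Final

end AbelianSchemeOver

end Literature.AlgebraicGeometry.AbelianSchemes

end
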